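import Mathlib
import Literature.Analysis.FluidPDE.VectorCalculus
import HarnessLib

/-!
# Route `EfficiencyFloor`, crux `NearSaturationNearMaximiser` (stmt-NavierStokesRegularity-25482; part 2/4 of the
# `LerayFloorGap` rung of `ProductionEfficiencyDecay`, stmt-22866): the AMPLITUDE HALF — near-saturation of the
# Lu–Doering cubic law pins the palinstrophy ratio to the Young optimum and the efficiency to `≥ 1 − δ`

Helper file (`--supports stmt-NavierStokesRegularity-25482 --as helper`; first helper on that item). The item says: given the
sharp one-sided Lu–Doering constant `c⋆` and `ε > 0` there is `δ > 0` such that every admissible field `v` whose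
instantaneous enstrophy production NEARLY SATURATES the cubic law,
`(1 − δ)·(27c⋆⁴/(128ν³))·Z³ ≤ 2S − 2ν·Pal` (`Z = ∫|curl v|²`, `Pal = ∫|∇curl v|²_F`, `S = ∫⟨curl v, ∇v·curl v⟩`),
is `ε`-close (scale-free `Ḣ¹ ∩ Ḣ²`) to a NORMALISED MAXIMISER `m` (`S(m) = c⋆Z^{3/4}Pal^{3/4}`,
`Pal(m) = (81c⋆⁴/(256ν⁴))·Z(m)³`). Its planner-stated mechanism has two halves: "strict Young pins the amplitude ratio,
efficiency `≥ (1−δ′)c⋆` pins the shape". THIS FILE PROVES THE FIRST HALF, as exact elementary inequalities between the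
three numbers `Z, Pal, S` (§1) and then for admissible fields (§2):

* `stretch_pos`, `palinstrophy_pos` — at a `(1−δ)`-saturated instant (`δ < 1`, `Z > 0`): `S > 0` and `Pal > 0`;
* `efficiency_ge` — **efficiency pinning**: `(1 − δ)·c·Z^{3/4}·Pal^{3/4} ≤ S` (`0 ≤ δ ≤ 1`; one line from the Young
  envelope `2cZ^{3/4}Pal^{3/4} − 2ν·Pal ≤ (27c⁴/(128ν³))Z³`, re-derived as `young_envelope` so that the file is
  route-independent; same statement as the tree's `LuDoeringRung.young_envelope`);
* `quarter_window` — **amplitude pinning**: `|Pal^{1/4} − (3c/(4ν))·Z^{3/4}| ≤ √δ·(3c/(4ν))·Z^{3/4}`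
  (in the variables `b = Pal^{1/4}`, `u = (3c/(4ν))Z^{3/4}` the saturation defect is the Lu–Doering polynomial
  `(2ν/3)·(3b⁴ − 4ub³ + u⁴) = (2ν/3)·(b − u)²(3b² + 2bu + u²) ≥ (2ν/3)·u²(b − u)²`, and it is `≤ δ·(2ν/3)u⁴`);
* `palinstrophy_le_window`, `window_le_palinstrophy` — hence the palinstrophy ratio sits in the window
  `(1 − √δ)⁴·λ⋆·Z³ ≤ Pal ≤ (1 + √δ)⁴·λ⋆·Z³`, `λ⋆ = 81c⁴/(256ν⁴)` the Young-optimal ratio of the item's normalisation;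
* `of_nearSaturation` (§2) — the same four facts for an admissible field `v` (smooth, divergence-free, `D⁰v, D¹v, D²v ∈ L²`)
  under the item's hypotheses VERBATIM (one-sided admissibility of `c`, `0 < Z(v)`, the `(1−δ)`-saturation inequality).

WHAT REMAINS OF stmt-25482 after this file (its exact open content, XL): the SHAPE half — an admissible field with
efficiency `S ≥ (1 − δ′)·c⋆·Z^{3/4}Pal^{3/4}` is `ε`-close in `Ḣ¹ ∩ Ḣ²`, after the Navier–Stokes scaling, to a maximiser
of the scale-invariant functional `S/(Z^{3/4}Pal^{3/4})` (attainment of `c⋆` on `ℝ³` included: concentration-compactness with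
vanishing excluded by the landed `EfficiencyConcentration` stmt-23111 and dichotomy by strict superadditivity). The
viscosity `ν`, the cubic law and the normalisation `Pal = λ⋆Z³` no longer appear in it: by `quarter_window` the field's own
ratio is already `(1 ± √δ)⁴`-close to `λ⋆`, so the nearest maximiser can be taken normalised.

HONEST FRAMING: inequalities between real numbers / about one HYPOTHETICAL near-saturating field; nothing about
Navier–Stokes dynamics is used; stmt-25482, `LerayFloorGap` (25164), `ProductionEfficiencyDecay` (22866) and
Navier–Stokes regularity stay OPEN; no summit statement is proved. Reference for the envelope and its optimum:
L. Lu, C. R. Doering, Indiana Univ. Math. J. 57 (2008) 2693–2727, eq. (5)–(6). [folklore]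
-/

-- the problem directory repeats the summit name (`NavierStokesRegularity/NavierStokesRegularity`)
set_option linter.dupNamespace false

noncomputable section

namespace Summit.NavierStokesRegularity.NavierStokesRegularity.Theorems

namespace NearSaturationNearMaximiser

namespace Amplitude

open MeasureTheory
open scoped InnerProductSpace
open Literature.Analysis.FluidPDE

/-! ### §1 Three real numbers `Z, Pal, S` at a near-saturated instant -/

section algebra

variable {c ν δ Z P S : ℝ}

/-- **Weighted AM–GM in Lu–Doering form** (re-derived here to keep this file route-independent; the same statement is
`ProductionEfficiencyDecay.LuDoeringRung.young_envelope` in the tree): for `Z, Pal ≥ 0`, `ν > 0` and any real `c`,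
`2cZ^{3/4}Pal^{3/4} − 2ν·Pal ≤ (27c⁴/(128ν³))Z³` — with `X = 4νPal^{1/4}`, `Y = 3cZ^{3/4}` this is `4X³Y ≤ 3X⁴ + Y⁴`.
[cite: LuDoering2008, eq. (6)] -/
theorem young_envelope (hν : 0 < ν) (hZ : 0 ≤ Z) (hP : 0 ≤ P) :
    2 * (c * Z ^ (3 / 4 : ℝ) * P ^ (3 / 4 : ℝ)) - 2 * ν * P ≤ 27 * c ^ 4 / (128 * ν ^ 3) * Z ^ 3 := by
  -- adapted from Theorems/EfficiencyFloorProductionEfficiencyDecayLuDoeringRung.lean (young_envelope)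
  set a : ℝ := P ^ (1 / 4 : ℝ) with ha_def
  set b : ℝ := Z ^ (3 / 4 : ℝ) with hb_def
  have ha : 0 ≤ a := Real.rpow_nonneg hP _
  have hb : 0 ≤ b := Real.rpow_nonneg hZ _
  have hP1 : P = a ^ 4 := by
    rw [ha_def, ← Real.rpow_mul_natCast hP]; norm_num
  have hP34 : P ^ (3 / 4 : ℝ) = a ^ 3 := by
    rw [ha_def, ← Real.rpow_mul_natCast hP]; norm_num
  have hZ3 : Z ^ 3 = b ^ 4 := by
    rw [hb_def, ← Real.rpow_mul_natCast hZ]; norm_num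
  rw [hP34, hZ3, hP1]
  have hν3 : 0 < 128 * ν ^ 3 := by positivity
  rw [div_mul_eq_mul_div, le_div_iff₀ hν3]
  have key : 0 ≤ (4 * ν * a - 3 * c * b) ^ 2 * (2 * (4 * ν * a) ^ 2 + (4 * ν * a + 3 * c * b) ^ 2) := by
    positivity
  nlinarith [key, ha, hb, hν]

/-- **Near-saturation forces positive stretching**: if `δ < 1`, `Z > 0`, `Pal ≥ 0` and
`(1−δ)(27c⁴/(128ν³))Z³ ≤ 2S − 2ν·Pal` with `c, ν > 0`, then `S > 0`. [folklore] -/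
theorem stretch_pos (hc : 0 < c) (hν : 0 < ν) (hδ : δ < 1) (hZ : 0 < Z) (hP : 0 ≤ P)
    (hsat : (1 - δ) * (27 * c ^ 4 / (128 * ν ^ 3)) * Z ^ 3 ≤ 2 * S - 2 * ν * P) : 0 < S := by
  have h1 : 0 < (1 - δ) * (27 * c ^ 4 / (128 * ν ^ 3)) * Z ^ 3 := by
    have : 0 < 1 - δ := by linarith
    positivity
  nlinarith [mul_nonneg hν.le hP]

/-- **Near-saturation forces positive palinstrophy**: under the one-sided envelope `S ≤ cZ^{3/4}Pal^{3/4}` a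
`(1−δ)`-saturated instant (`δ < 1`, `Z > 0`) has `Pal > 0` (else `S ≤ 0 < S`). [folklore] -/
theorem palinstrophy_pos (hc : 0 < c) (hν : 0 < ν) (hδ : δ < 1) (hZ : 0 < Z) (hP : 0 ≤ P)
    (hS : S ≤ c * Z ^ (3 / 4 : ℝ) * P ^ (3 / 4 : ℝ))
    (hsat : (1 - δ) * (27 * c ^ 4 / (128 * ν ^ 3)) * Z ^ 3 ≤ 2 * S - 2 * ν * P) : 0 < P := by
  rcases hP.eq_or_lt with h | h
  · exfalso
    have hS0 : S ≤ 0 := by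
      rw [← h, Real.zero_rpow (by norm_num : (3 / 4 : ℝ) ≠ 0), mul_zero] at hS
      exact hS
    have := stretch_pos hc hν hδ hZ hP hsat
    linarith
  · exact h

/-- **EFFICIENCY PINNING.** For `0 ≤ δ ≤ 1`, `Z, Pal ≥ 0`, `ν > 0` and any real `c`: if
`(1−δ)(27c⁴/(128ν³))Z³ ≤ 2S − 2ν·Pal` then `(1−δ)·cZ^{3/4}Pal^{3/4} ≤ S` — the efficiency `S/(cZ^{3/4}Pal^{3/4})` is at
least `1 − δ`. (Multiply the Young envelope `young_envelope` by `1−δ` and compare.)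
[folklore] -/
theorem efficiency_ge (hν : 0 < ν) (hδ0 : 0 ≤ δ) (hδ1 : δ ≤ 1) (hZ : 0 ≤ Z) (hP : 0 ≤ P)
    (hsat : (1 - δ) * (27 * c ^ 4 / (128 * ν ^ 3)) * Z ^ 3 ≤ 2 * S - 2 * ν * P) :
    (1 - δ) * (c * Z ^ (3 / 4 : ℝ) * P ^ (3 / 4 : ℝ)) ≤ S := by
  have hY := young_envelope (c := c) hν hZ hP
  have h1 : (1 - δ) * (2 * (c * Z ^ (3 / 4 : ℝ) * P ^ (3 / 4 : ℝ)) - 2 * ν * P) ≤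
      (1 - δ) * (27 * c ^ 4 / (128 * ν ^ 3) * Z ^ 3) :=
    mul_le_mul_of_nonneg_left hY (by linarith)
  have h2 : 0 ≤ δ * (ν * P) := mul_nonneg hδ0 (mul_nonneg hν.le hP)
  nlinarith [h1, hsat, h2]

/-- **AMPLITUDE PINNING (quarter-power form).** For `c, ν > 0`, `Z > 0`, `Pal ≥ 0`, the one-sided envelope
`S ≤ cZ^{3/4}Pal^{3/4}` and `(1−δ)`-saturation `(1−δ)(27c⁴/(128ν³))Z³ ≤ 2S − 2ν·Pal`:
`|Pal^{1/4} − (3c/(4ν))Z^{3/4}| ≤ √δ · (3c/(4ν))Z^{3/4}`. With `b = Pal^{1/4}`, `u = (3c/(4ν))Z^{3/4}` the two hypotheses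
give `3b⁴ − 4ub³ + u⁴ ≤ δu⁴`, and `3b⁴ − 4ub³ + u⁴ = (b−u)²(3b² + 2bu + u²) ≥ u²(b−u)²`. (For `δ < 0` the hypotheses
force `b = u` and the bound reads `0 ≤ 0`.) [folklore] -/
theorem quarter_window (hc : 0 < c) (hν : 0 < ν) (hZ : 0 < Z) (hP : 0 ≤ P)
    (hS : S ≤ c * Z ^ (3 / 4 : ℝ) * P ^ (3 / 4 : ℝ))
    (hsat : (1 - δ) * (27 * c ^ 4 / (128 * ν ^ 3)) * Z ^ 3 ≤ 2 * S - 2 * ν * P) :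
    |P ^ (1 / 4 : ℝ) - 3 * c / (4 * ν) * Z ^ (3 / 4 : ℝ)| ≤
      Real.sqrt δ * (3 * c / (4 * ν) * Z ^ (3 / 4 : ℝ)) := by
  set b : ℝ := P ^ (1 / 4 : ℝ) with hb_def
  set a : ℝ := Z ^ (3 / 4 : ℝ) with ha_def
  have hb : 0 ≤ b := Real.rpow_nonneg hP _
  have ha : 0 < a := Real.rpow_pos_of_pos hZ _
  have hP1 : P = b ^ 4 := by
    rw [hb_def, ← Real.rpow_mul_natCast hP]; norm_num
  have hP34 : P ^ (3 / 4 : ℝ) = b ^ 3 := by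
    rw [hb_def, ← Real.rpow_mul_natCast hP]; norm_num
  have hZ3 : Z ^ 3 = a ^ 4 := by
    rw [ha_def, ← Real.rpow_mul_natCast hZ.le]; norm_num
  rw [hP34] at hS
  set u : ℝ := 3 * c / (4 * ν) * a with hu_def
  have hu : 0 < u := by positivity
  -- the two hypotheses in the variables `a, b`
  have h1 : (1 - δ) * (27 * c ^ 4 / (128 * ν ^ 3)) * a ^ 4 + 2 * ν * b ^ 4 ≤ 2 * (c * a * b ^ 3) := by
    rw [← hZ3, ← hP1]
    linarith [hsat, hS]
  -- the Lu–Doering polynomial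
  have hid1 : 2 * ν / 3 * (3 * b ^ 4 - 4 * u * b ^ 3 + u ^ 4) =
      2 * ν * b ^ 4 - 2 * (c * a * b ^ 3) + 27 * c ^ 4 / (128 * ν ^ 3) * a ^ 4 := by
    rw [hu_def]; field_simp; ring
  have hid2 : 2 * ν / 3 * (δ * u ^ 4) = δ * (27 * c ^ 4 / (128 * ν ^ 3)) * a ^ 4 := by
    rw [hu_def]; field_simp; ring
  have h23 : 0 < 2 * ν / 3 := by positivity
  have hpoly : 3 * b ^ 4 - 4 * u * b ^ 3 + u ^ 4 ≤ δ * u ^ 4 := by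
    have h3 : 2 * ν / 3 * (3 * b ^ 4 - 4 * u * b ^ 3 + u ^ 4) ≤ 2 * ν / 3 * (δ * u ^ 4) := by
      rw [hid1, hid2]; linarith [h1]
    exact le_of_mul_le_mul_left h3 h23
  have hfac : 3 * b ^ 4 - 4 * u * b ^ 3 + u ^ 4 = (b - u) ^ 2 * (3 * b ^ 2 + 2 * b * u + u ^ 2) := by
    ring
  have hmono : (b - u) ^ 2 * u ^ 2 ≤ (b - u) ^ 2 * (3 * b ^ 2 + 2 * b * u + u ^ 2) :=
    mul_le_mul_of_nonneg_left (by nlinarith [hb, hu.le]) (sq_nonneg _)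
  have hsq : (b - u) ^ 2 * u ^ 2 ≤ δ * u ^ 2 * u ^ 2 := by
    calc (b - u) ^ 2 * u ^ 2 ≤ (b - u) ^ 2 * (3 * b ^ 2 + 2 * b * u + u ^ 2) := hmono
      _ = 3 * b ^ 4 - 4 * u * b ^ 3 + u ^ 4 := hfac.symm
      _ ≤ δ * u ^ 4 := hpoly
      _ = δ * u ^ 2 * u ^ 2 := by ring
  have hsq' : (b - u) ^ 2 ≤ δ * u ^ 2 := le_of_mul_le_mul_right hsq (by positivity)
  calc |b - u| ≤ Real.sqrt (δ * u ^ 2) := Real.abs_le_sqrt hsq'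
    _ = Real.sqrt δ * u := by rw [Real.sqrt_mul' δ (by positivity), Real.sqrt_sq hu.le]

/-- **The palinstrophy window, upper half**: under the hypotheses of `quarter_window`,
`Pal ≤ (1 + √δ)⁴ · (81c⁴/(256ν⁴)) · Z³` (`81c⁴/(256ν⁴) = (3c/(4ν))⁴` is the Young-optimal ratio `Pal/Z³`). [folklore] -/
theorem palinstrophy_le_window (hc : 0 < c) (hν : 0 < ν) (hZ : 0 < Z) (hP : 0 ≤ P)
    (hS : S ≤ c * Z ^ (3 / 4 : ℝ) * P ^ (3 / 4 : ℝ))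
    (hsat : (1 - δ) * (27 * c ^ 4 / (128 * ν ^ 3)) * Z ^ 3 ≤ 2 * S - 2 * ν * P) :
    P ≤ (1 + Real.sqrt δ) ^ 4 * (81 * c ^ 4 / (256 * ν ^ 4)) * Z ^ 3 := by
  have hw := quarter_window hc hν hZ hP hS hsat
  set b : ℝ := P ^ (1 / 4 : ℝ) with hb_def
  set a : ℝ := Z ^ (3 / 4 : ℝ) with ha_def
  have hb : 0 ≤ b := Real.rpow_nonneg hP _
  have hP1 : P = b ^ 4 := by
    rw [hb_def, ← Real.rpow_mul_natCast hP]; norm_num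
  have hZ3 : Z ^ 3 = a ^ 4 := by
    rw [ha_def, ← Real.rpow_mul_natCast hZ.le]; norm_num
  set u : ℝ := 3 * c / (4 * ν) * a with hu_def
  have h1 : b ≤ (1 + Real.sqrt δ) * u := by
    have := (abs_le.1 hw).2
    linarith
  calc P = b ^ 4 := hP1
    _ ≤ ((1 + Real.sqrt δ) * u) ^ 4 := pow_le_pow_left₀ hb h1 4
    _ = (1 + Real.sqrt δ) ^ 4 * (81 * c ^ 4 / (256 * ν ^ 4)) * Z ^ 3 := by
        rw [hZ3, hu_def]; field_simp; ring

/-- **The palinstrophy window, lower half**: under the hypotheses of `quarter_window` and `δ ≤ 1`,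
`(1 − √δ)⁴ · (81c⁴/(256ν⁴)) · Z³ ≤ Pal`. [folklore] -/
theorem window_le_palinstrophy (hc : 0 < c) (hν : 0 < ν) (hδ1 : δ ≤ 1) (hZ : 0 < Z) (hP : 0 ≤ P)
    (hS : S ≤ c * Z ^ (3 / 4 : ℝ) * P ^ (3 / 4 : ℝ))
    (hsat : (1 - δ) * (27 * c ^ 4 / (128 * ν ^ 3)) * Z ^ 3 ≤ 2 * S - 2 * ν * P) :
    (1 - Real.sqrt δ) ^ 4 * (81 * c ^ 4 / (256 * ν ^ 4)) * Z ^ 3 ≤ P := by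
  have hw := quarter_window hc hν hZ hP hS hsat
  set b : ℝ := P ^ (1 / 4 : ℝ) with hb_def
  set a : ℝ := Z ^ (3 / 4 : ℝ) with ha_def
  have ha : 0 < a := Real.rpow_pos_of_pos hZ _
  have hP1 : P = b ^ 4 := by
    rw [hb_def, ← Real.rpow_mul_natCast hP]; norm_num
  have hZ3 : Z ^ 3 = a ^ 4 := by
    rw [ha_def, ← Real.rpow_mul_natCast hZ.le]; norm_num
  set u : ℝ := 3 * c / (4 * ν) * a with hu_def
  have hu : 0 < u := by positivity
  have hs1 : Real.sqrt δ ≤ 1 := by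
    rw [← Real.sqrt_one]
    exact Real.sqrt_le_sqrt hδ1
  have h0 : 0 ≤ (1 - Real.sqrt δ) * u := mul_nonneg (by linarith) hu.le
  have h1 : (1 - Real.sqrt δ) * u ≤ b := by
    have := (abs_le.1 hw).1
    linarith
  calc (1 - Real.sqrt δ) ^ 4 * (81 * c ^ 4 / (256 * ν ^ 4)) * Z ^ 3 = ((1 - Real.sqrt δ) * u) ^ 4 := by
        rw [hZ3, hu_def]; field_simp; ring
    _ ≤ b ^ 4 := pow_le_pow_left₀ h0 h1 4
    _ = P := hP1.symm

end algebra

/-! ### §2 For an admissible field, under the hypotheses of the item verbatim -/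

/-- **The amplitude half of `NearSaturationNearMaximiser` (stmt-25482).** Let `c > 0` be one-sided admissible
(`∫⟨curl w, ∇w·curl w⟩ ≤ c·Z(w)^{3/4}·Pal(w)^{3/4}` for every smooth divergence-free `w` with `D⁰w, D¹w, D²w ∈ L²` — in
particular the sharp constant `c⋆` of the item), `ν > 0`, `0 ≤ δ ≤ 1`, `δ < 1`, and let `v` be such a field with `Z(v) > 0`
whose production `(1−δ)`-saturates the cubic law, `(1−δ)(27c⁴/(128ν³))Z(v)³ ≤ 2S(v) − 2ν·Pal(v)`. Then: `Pal(v) > 0`;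
the efficiency is pinned, `(1−δ)·c·Z^{3/4}Pal^{3/4} ≤ S`; and the amplitude ratio is pinned,
`|Pal^{1/4} − (3c/(4ν))Z^{3/4}| ≤ √δ·(3c/(4ν))Z^{3/4}` and `(1−√δ)⁴λ⋆Z³ ≤ Pal ≤ (1+√δ)⁴λ⋆Z³`, `λ⋆ = 81c⁴/(256ν⁴)` (the
item's normalisation of maximisers). The SHAPE half of the item (ε-closeness to a maximiser) is NOT proved here. [folklore] -/
theorem of_nearSaturation (c ν δ : ℝ) (hc : 0 < c)
    (hadm : ∀ w : EuclideanSpace ℝ (Fin 3) → EuclideanSpace ℝ (Fin 3),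
      (ContDiff ℝ (⊤ : ℕ∞) w ∧ Literature.Analysis.FluidPDE.VectorCalculus.IsDivFree w ∧
        (∫⁻ x, ‖iteratedFDeriv ℝ 0 w x‖ₑ ^ 2 < ⊤) ∧ (∫⁻ x, ‖iteratedFDeriv ℝ 1 w x‖ₑ ^ 2 < ⊤) ∧
        (∫⁻ x, ‖iteratedFDeriv ℝ 2 w x‖ₑ ^ 2 < ⊤)) →
      (∫ x, ⟪curl w x, fderiv ℝ w x (curl w x)⟫_ℝ) ≤
        c * (∫ x, ‖curl w x‖ ^ 2) ^ (3 / 4 : ℝ) * (∫ x, frobeniusNormSq (fderiv ℝ (curl w) x)) ^ (3 / 4 : ℝ))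
    (hν : 0 < ν) (hδ0 : 0 ≤ δ) (hδ1 : δ < 1)
    (v : EuclideanSpace ℝ (Fin 3) → EuclideanSpace ℝ (Fin 3))
    (hv : ContDiff ℝ (⊤ : ℕ∞) v ∧ Literature.Analysis.FluidPDE.VectorCalculus.IsDivFree v ∧
      (∫⁻ x, ‖iteratedFDeriv ℝ 0 v x‖ₑ ^ 2 < ⊤) ∧ (∫⁻ x, ‖iteratedFDeriv ℝ 1 v x‖ₑ ^ 2 < ⊤) ∧
      (∫⁻ x, ‖iteratedFDeriv ℝ 2 v x‖ₑ ^ 2 < ⊤))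
    (hZ : 0 < ∫ x, ‖curl v x‖ ^ 2)
    (hsat : (1 - δ) * (27 * c ^ 4 / (128 * ν ^ 3)) * (∫ x, ‖curl v x‖ ^ 2) ^ 3 ≤
      2 * (∫ x, ⟪curl v x, fderiv ℝ v x (curl v x)⟫_ℝ) - 2 * ν * (∫ x, frobeniusNormSq (fderiv ℝ (curl v) x))) :
    0 < (∫ x, frobeniusNormSq (fderiv ℝ (curl v) x)) ∧
    (1 - δ) * (c * (∫ x, ‖curl v x‖ ^ 2) ^ (3 / 4 : ℝ) *
        (∫ x, frobeniusNormSq (fderiv ℝ (curl v) x)) ^ (3 / 4 : ℝ)) ≤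
      (∫ x, ⟪curl v x, fderiv ℝ v x (curl v x)⟫_ℝ) ∧
    |(∫ x, frobeniusNormSq (fderiv ℝ (curl v) x)) ^ (1 / 4 : ℝ) -
        3 * c / (4 * ν) * (∫ x, ‖curl v x‖ ^ 2) ^ (3 / 4 : ℝ)| ≤
      Real.sqrt δ * (3 * c / (4 * ν) * (∫ x, ‖curl v x‖ ^ 2) ^ (3 / 4 : ℝ)) ∧
    (1 - Real.sqrt δ) ^ 4 * (81 * c ^ 4 / (256 * ν ^ 4)) * (∫ x, ‖curl v x‖ ^ 2) ^ 3 ≤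
      (∫ x, frobeniusNormSq (fderiv ℝ (curl v) x)) ∧
    (∫ x, frobeniusNormSq (fderiv ℝ (curl v) x)) ≤
      (1 + Real.sqrt δ) ^ 4 * (81 * c ^ 4 / (256 * ν ^ 4)) * (∫ x, ‖curl v x‖ ^ 2) ^ 3 := by
  have hP : 0 ≤ ∫ x, frobeniusNormSq (fderiv ℝ (curl v) x) :=
    integral_nonneg fun x => frobeniusNormSq_nonneg _
  have hS := hadm v hv
  exact ⟨palinstrophy_pos hc hν hδ1 hZ hP hS hsat, efficiency_ge hν hδ0 hδ1.le hZ.le hP hsat,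
    quarter_window hc hν hZ hP hS hsat, window_le_palinstrophy hc hν hδ1.le hZ hP hS hsat,
    palinstrophy_le_window hc hν hZ hP hS hsat⟩

end Amplitude

end NearSaturationNearMaximiser

end Summit.NavierStokesRegularity.NavierStokesRegularity.Theorems

end
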